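import Literature.AlgebraicGeometry.AbelianSchemes.PolarizedAbelianSchemeWithLevelBaseChange
import Literature.AlgebraicGeometry.AbelianSchemes.AbelianSchemeIsLambdaOfAtConjugate
import HarnessLib

/-!
# The `σ`-reading of the level Weil pairing on the re-base `P′ ×_{Spec ℂ, Spec σ} Spec ℂ` of a polarised abelian scheme
# (Milne, *Shimura varieties* §14 «`σ(A, s, ηK) = (σA, σs, σηK)`» read on `e_N`; Shimura 1998 §18.6; Lang VII §2 Prop. 3)

Layer `Literature/AlgebraicGeometry/AbelianSchemes`; namespaces `…AbelianSchemes.AbelianSchemeOver` (§1–§2) and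
`…AbelianSchemes.PolarizedAbelianSchemeWithLevel` (§3).  KERNEL ONLY: theorems; no definition, no named fact, no
instance, no `sorry`.  Cell `hodgecm-mathlib`, M1PRIME-DAG rung 0, W3 text of record `DBCSigmaExportR` (B-plan1 P41 /
R16 (b)): this file is the `hpair` conjunct for the re-base `rebaseSpecMap σ P′` of ★ `PolarizedAbelianSchemeWithLevelBaseChange`
(B-p13), i.e. H1 of record is ★ `exists_rebase_specMap_conjFibre` + `weilPairingLevel_rebaseSpecMap_eq_conjugate` below.

THE PRINT.  [Milne2005ShimuraVarieties, §14 pp. 124–125]: «`σ(A, s, ηK) = (σA, σs, σηK)`» — the conjugate of a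
polarised abelian variety with level structure is the conjugate variety with the conjugate polarisation; on the
`e_N`-pairings of the polarisation this reads `e^{σs}_N(P^σ, Q^σ) = σ(e^{s}_N(P, Q))` ([Shimura1998, §18.6 proof
pp. 129–131]: `e_N^{X^σ}(t^σ, s^σ) = e_N^X(t, s)^σ`; [Lang1983AbelianVarieties, VII §2 Prop. 3]: `e_N` is defined over
the field of definition and depends only on the divisor class).  In [MumfordFogartyKirwan1994, Ch. 7 §2 Def. 7.2]'s
moduli problem the conjugate triple IS the base change along `Spec σ` («a contravariant functor … in the obvious way»),
whose polarisation is `Λ(L̄)` at every geometric point for SOME ample `L̄` (Def. 6.3); the theorem says that whichever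
witness `Θσ` of `λ̄_{Pσ} = Λ(𝒪(Θσ))` at the point `𝟙` of the re-base is chosen, its level Weil pairing at the points
corresponding to `P^σ, Q^σ` under the fibre identification `jσ : fibre(Pσ) ≅ fibre(P′)^σ` (★ `rebaseSpecMapConjIso`)
is `σ` of the pairing of any witness `Θ₁` of `λ̄_{P′} = Λ(𝒪(Θ₁))` at `𝟙`.

WHAT IS PROVED (composition of ★ lemmas; no new mathematics beyond ★ `AbelianSchemeIsLambdaOfAtConjugate`):
* §1 `IsLambdaOfAt.transfer_sameDivisor` — `λ̄ = Λ(𝒪(Θ))` is insensitive to re-presenting `Θ` by the SAME divisor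
  (det-class: `[Θ] = [Θ′]` in `Ȟ¹`, ★ `SameDivisor.cechClass_eq`, ★ `nonempty_iso_iff_detClass_eq`);
* §2 `IsLambdaOfAt.of_point_eq` — transport along an EQUALITY of base points `s₁ = s₂` (B-p13's `fibreCongrIso`,
  `eqToIso`; by `subst`), the bookkeeping between the two spellings `𝟙 ≫ Spec σ` and `specTwist σ ≫ 𝟙` of the twisted
  point;
* §3 **`PolarizedAbelianSchemeWithLevel.weilPairingLevel_rebaseSpecMap_eq_conjugate`** — for `P′` over `Spec ℂ`,
  `σ ∈ Aut(ℂ/ℚ)`, a witness `Θ₁` of `λ̄_{P′}` at `𝟙`, ANY witness `Θσ` of `λ̄_{Pσ}` at `𝟙` (`Pσ := P′.rebaseSpecMap σ`),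
  `(M : ℂ) ≠ 0`, and `M`-torsion points with `jσ(Pt) = P^σ`, `jσ(Qt) = Q^σ`:
  `ē^{Θσ}_M(Pt, Qt) = σ (ē^{Θ₁}_M(P, Q))`.  Chain: ★ `IsLambdaOfAt.of_baseChange` (B-p02 §3a: `Θσ` descends to a witness
  at the point `𝟙 ≫ Spec σ` of `P′`) → §2 (point `specTwist σ ≫ 𝟙`) → ★ `IsLambdaOfAt.weilPairingLevel_specTwist_eq_conjugate`
  (witness-independence + the `σ`-twist of the base point + `ē^{Θ^σ}(P^σ, Q^σ) = σ ē^{Θ}(P, Q)`) → ★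
  `weilPairingLevel_pullback_eq` along `fibreBaseChangeIso ≪≫ fibreCongrIso` back to `(Θσ, Pt, Qt)`.

HC_CM is proved only modulo the 7 printed citations until rung 0 closes; this file discharges none of them (it closes
the `hpair` conjunct of the W3 leaf H1 of the M1′ skeleton).

## References
* [Milne2005ShimuraVarieties] J. S. Milne, *Introduction to Shimura varieties* (2005/2017), §14 pp. 124–125.
* [Shimura1998] G. Shimura, *Abelian Varieties with Complex Multiplication and Modular Functions* (1998), §18.6 proof
  (pp. 129–131).
* [Lang1983AbelianVarieties] S. Lang, *Abelian Varieties*, Ch. VII §2 Prop. 3.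
* [MumfordFogartyKirwan1994] D. Mumford, J. Fogarty, F. Kirwan, *Geometric Invariant Theory*, 3rd ed. (1994), Ch. 6 §2
  Def. 6.2–6.3 (p. 120), Ch. 7 §2 Def. 7.2 (p. 129).
* [GortzWedhorn2020] U. Görtz, T. Wedhorn, *Algebraic Geometry I*, 2nd ed. (2020), Section (4.7), Prop. 11.21 (p. 374).
* [Hartshorne1977] R. Hartshorne, *Algebraic Geometry* (1977), III Ex. 4.5.
-/

universe u

open CategoryTheory CategoryTheory.Limits AlgebraicGeometry MonoidalCategory

noncomputable section

namespace Literature.AlgebraicGeometry.AbelianSchemes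

open Literature.AlgebraicGeometry.Motives Literature.AlgebraicGeometry.AbelianVarieties
  Literature.AlgebraicGeometry.Modules
open scoped MonObj CategoryTheory.Obj

namespace AbelianSchemeOver

set_option backward.isDefEq.respectTransparency false

variable {S : Scheme.{u}} (A : AbelianSchemeOver S) (D : A.DualPair) (lam : A.X ⟶ D.hat.X)
  {L : Type u} [Field L]

/-! ### §1 `λ̄ = Λ(𝒪(Θ))` is insensitive to re-presenting `Θ` by the same divisor -/

/-- **`λ̄ = Λ(𝒪(Θ))` at `s` and `Θ ∼ Θ′` the SAME divisor ⟹ `λ̄ = Λ(𝒪(Θ′))` at `s`**: `[Θ] = [Θ′]` in `Ȟ¹(A_s, 𝒪^×)`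
([GortzWedhorn2020, Prop. 11.21]), so `t_P^*𝒪(Θ) ⊗ 𝒪(Θ)⁻¹ ≅ t_P^*𝒪(Θ′) ⊗ 𝒪(Θ′)⁻¹` (rank one, equal determinant
classes, [Hartshorne1977, III Ex. 4.5]) and [MumfordFogartyKirwan1994, Def. 6.2]'s isomorphism composes.
[cite: MumfordFogartyKirwan1994, Ch. 6 §2 Definition 6.2–6.3 (p. 120)] [cite: GortzWedhorn2020, Prop. 11.21 (p. 374)]
[cite: Hartshorne1977, III Ex. 4.5] -/
theorem IsLambdaOfAt.transfer_sameDivisor {s : Spec (.of L) ⟶ S}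
    {Θ Θ' : CartierDivisor (A.fibre s).toAbelianVariety.X.left} (h : A.IsLambdaOfAt s D lam Θ)
    (hΘ : Θ.SameDivisor Θ') : A.IsLambdaOfAt s D lam Θ' := by
  intro P
  obtain ⟨i⟩ := h P
  have hr : HasRank (tensorObj
      ((Scheme.Modules.pullback ((A.fibre s).toAbelianVariety.translation P).left).obj (A.lineBundleOfDivisor s Θ))
      (Modules.dual (A.lineBundleOfDivisor s Θ))) 1 :=
    hasRank_tensorObj_one (hasRank_pullback _ (A.hasRank_lineBundleOfDivisor _ Θ))
      (hasRank_dual (A.hasRank_lineBundleOfDivisor _ Θ))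
  have hr' : HasRank (tensorObj
      ((Scheme.Modules.pullback ((A.fibre s).toAbelianVariety.translation P).left).obj (A.lineBundleOfDivisor s Θ'))
      (Modules.dual (A.lineBundleOfDivisor s Θ'))) 1 :=
    hasRank_tensorObj_one (hasRank_pullback _ (A.hasRank_lineBundleOfDivisor _ Θ'))
      (hasRank_dual (A.hasRank_lineBundleOfDivisor _ Θ'))
  obtain ⟨j⟩ := (nonempty_iso_iff_detClass_eq hr hr' (HasRank.isFiniteLocallyFree' hr)
    (HasRank.isFiniteLocallyFree' hr')).2 (by
      rw [A.detClass_translationPullback_tensor_dual s Θ P (HasRank.isFiniteLocallyFree' hr),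
        A.detClass_translationPullback_tensor_dual s Θ' P (HasRank.isFiniteLocallyFree' hr'), hΘ.cechClass_eq])
  exact ⟨i ≪≫ j⟩

/-! ### §2 Transport along an equality of base points (`fibreCongrIso`) -/

/-- The underlying scheme morphism of `fibreCongrIso rfl` is the identity. [cite: GortzWedhorn2020, Section (4.7) (p. 135)] -/
theorem toSchemeHom_fibreCongrIso_inv_eq_id (s : Spec (.of L) ⟶ S) :
    AbelianVariety.Hom.toSchemeHom (A.fibreCongrIso (rfl : s = s)).inv = 𝟙 _ :=
  rfl

/-- **`λ̄ = Λ(𝒪(Θ))` at `s₁` ⟹ at `s₂ = s₁` for the transported divisor** (transport of [MumfordFogartyKirwan1994,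
Def. 6.2] along the `eqToIso` identification `fibreCongrIso : A_{s₁} ≅ A_{s₂}` of ★ `PolarizedAbelianSchemeWithLevelBaseChange`;
the bookkeeping between propositionally equal spellings of one geometric point). [cite: MumfordFogartyKirwan1994, Ch. 6 §2 Definition 6.2–6.3 (p. 120)]
[cite: GortzWedhorn2020, Section (4.7) (p. 135)] -/
theorem IsLambdaOfAt.of_point_eq {s₁ s₂ : Spec (.of L) ⟶ S} (h12 : s₁ = s₂)
    {Θ : CartierDivisor (A.fibre s₁).toAbelianVariety.X.left} (h : A.IsLambdaOfAt s₁ D lam Θ) :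
    haveI : IsDominant (AbelianVariety.Hom.toSchemeHom (A.fibreCongrIso h12).inv) :=
      AbelianVariety.isDominant_toSchemeHom_iso_hom (A.fibreCongrIso h12).symm
    A.IsLambdaOfAt s₂ D lam (Θ.pullback (AbelianVariety.Hom.toSchemeHom (A.fibreCongrIso h12).inv)) := by
  subst h12
  haveI : IsDominant (AbelianVariety.Hom.toSchemeHom (A.fibreCongrIso (rfl : s₁ = s₁)).inv) :=
    AbelianVariety.isDominant_toSchemeHom_iso_hom (A.fibreCongrIso rfl).symm
  exact h.transfer_sameDivisor A D lam
    ((Θ.pullback_congr_sameDivisor (A.toSchemeHom_fibreCongrIso_inv_eq_id s₁)).trans Θ.pullback_id_sameDivisor).symm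

/-- `e(e⁻¹(x)) = x` on `L`-points for an isomorphism `e` of abelian varieties. [cite: MumfordAV1970, §4 (Cor. 1 of the rigidity lemma)] -/
theorem _root_.Literature.AlgebraicGeometry.Motives.AbelianVariety.map_hom_map_inv_of_iso {K : Type u} [Field K]
    {B C : AbelianVariety K} (e : B ≅ C) (x : C.Points K) :
    AlgPoints.map e.hom.hom.hom.hom (AlgPoints.map e.inv.hom.hom.hom x) = x := by
  have h : e.inv.hom.hom.hom ≫ e.hom.hom.hom.hom = 𝟙 _ := by
    change (e.inv ≫ e.hom).hom.hom.hom = _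
    rw [Iso.inv_hom_id]
    rfl
  rw [← AlgPoints.map_comp_apply, h, AlgPoints.map_id_apply]

/-- `e⁻¹(e(x)) = x` on `L`-points for an isomorphism `e` of abelian varieties. [cite: MumfordAV1970, §4 (Cor. 1 of the rigidity lemma)] -/
theorem _root_.Literature.AlgebraicGeometry.Motives.AbelianVariety.map_inv_map_hom_of_iso {K : Type u} [Field K]
    {B C : AbelianVariety K} (e : B ≅ C) (x : B.Points K) :
    AlgPoints.map e.inv.hom.hom.hom (AlgPoints.map e.hom.hom.hom.hom x) = x := by
  have h : e.hom.hom.hom.hom ≫ e.inv.hom.hom.hom = 𝟙 _ := by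
    change (e.hom ≫ e.inv).hom.hom.hom = _
    rw [Iso.hom_inv_id]
    rfl
  rw [← AlgPoints.map_comp_apply, h, AlgPoints.map_id_apply]

end AbelianSchemeOver

/-! ### §3 The `σ`-reading of the pairing on the re-base `rebaseSpecMap σ P′` -/

namespace PolarizedAbelianSchemeWithLevel

set_option backward.isDefEq.respectTransparency false

open AbelianSchemeOver

variable {g₀ N : ℕ} {δ : Fin g₀ → ℕ}

/-- `𝟙 ≫ Spec σ = specTwist σ ≫ 𝟙` (the two spellings of the twisted point of `Spec ℂ`). [cite: GortzWedhorn2020, Section (4.7) (p. 135)] -/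
theorem id_comp_specMap_left_eq_specTwist_comp_id (σ : ℂ ≃ₐ[ℚ] ℂ) :
    𝟙 (Spec (CommRingCat.of ℂ)) ≫ (AlgPoints.specMap σ).left =
      AbelianSchemeOver.specTwist σ.toRingEquiv ≫ 𝟙 (Spec (CommRingCat.of ℂ)) := by
  rw [Category.id_comp, Category.comp_id]
  rfl

/-- **THE `σ`-READING OF THE WEIL PAIRING ON THE RE-BASE** (`hpair` of the W3 text of record `DBCSigmaExportR`):
for `P′` over `Spec ℂ`, `σ ∈ Aut(ℂ/ℚ)`, a witness `Θ₁` of `λ̄_{P′} = Λ(𝒪(Θ₁))` at `𝟙`, ANY witness `Θσ` of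
`λ̄_{Pσ} = Λ(𝒪(Θσ))` at `𝟙` (`Pσ = P′.rebaseSpecMap σ`), `(M : ℂ) ≠ 0`, and `M`-torsion points `P, Q` of `fibre(P′)`,
`Pt, Qt` of `fibre(Pσ)` with `jσ(Pt) = P^σ`, `jσ(Qt) = Q^σ` (`jσ = rebaseSpecMapConjIso`): **`ē^{Θσ}_M(Pt, Qt) =
σ (ē^{Θ₁}_M(P, Q))`** — Milne's «`σ(A, s, ηK) = (σA, σs, σηK)`» on the `e_N`-pairing of the polarisation, Shimura's
`e_N^{X^σ}(t^σ, s^σ) = e_N^X(t, s)^σ`. [cite: Milne2005ShimuraVarieties, §14 pp. 124–125]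
[cite: Shimura1998, §18.6 proof (p. 130)] [cite: Lang1983AbelianVarieties, Ch. VII §2 Prop. 3] -/
theorem weilPairingLevel_rebaseSpecMap_eq_conjugate (σ : ℂ ≃ₐ[ℚ] ℂ)
    (P' : PolarizedAbelianSchemeWithLevel g₀ N δ (specOver ℚ ℂ).left)
    {Θ₁ : CartierDivisor (P'.A.fibre (𝟙 (Spec (CommRingCat.of ℂ)))).toAbelianVariety.X.left}
    (hlam₁ : P'.A.IsLambdaOfAt (𝟙 (Spec (CommRingCat.of ℂ))) P'.D P'.pol.lam Θ₁)
    {Θσ : CartierDivisor ((P'.rebaseSpecMap σ).A.fibre (𝟙 (Spec (CommRingCat.of ℂ)))).toAbelianVariety.X.left}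
    (hlamσ : (P'.rebaseSpecMap σ).A.IsLambdaOfAt (𝟙 (Spec (CommRingCat.of ℂ))) (P'.rebaseSpecMap σ).D
      (P'.rebaseSpecMap σ).pol.lam Θσ)
    {M : ℕ} (hM : (M : ℂ) ≠ 0)
    [IsDominant (AbelianVariety.Hom.toSchemeHom
      ((M : ℤ) • 𝟙 (P'.A.fibre (𝟙 (Spec (CommRingCat.of ℂ)))).toAbelianVariety))]
    [IsDominant (AbelianVariety.Hom.toSchemeHom
      ((M : ℤ) • 𝟙 ((P'.rebaseSpecMap σ).A.fibre (𝟙 (Spec (CommRingCat.of ℂ)))).toAbelianVariety))]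
    (P Q : ((P'.A.fibre (𝟙 (Spec (CommRingCat.of ℂ)))).toAbelianVariety).torsionPoints ℂ M)
    (Pt Qt : (((P'.rebaseSpecMap σ).A.fibre (𝟙 (Spec (CommRingCat.of ℂ)))).toAbelianVariety).torsionPoints ℂ M)
    (hP : AlgPoints.map (P'.rebaseSpecMapConjIso σ).hom.hom.hom.hom Pt.1 =
      ((P'.A.fibre (𝟙 (Spec (CommRingCat.of ℂ)))).toAbelianVariety).conjPoints σ.toRingEquiv P.1)
    (hQ : AlgPoints.map (P'.rebaseSpecMapConjIso σ).hom.hom.hom.hom Qt.1 =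
      ((P'.A.fibre (𝟙 (Spec (CommRingCat.of ℂ)))).toAbelianVariety).conjPoints σ.toRingEquiv Q.1) :
    (((P'.rebaseSpecMap σ).A.fibre (𝟙 (Spec (CommRingCat.of ℂ)))).toAbelianVariety).weilPairingLevel Θσ Pt Qt =
      σ (((P'.A.fibre (𝟙 (Spec (CommRingCat.of ℂ)))).toAbelianVariety).weilPairingLevel Θ₁ P Q) := by
  -- notation: the base map `g = Spec σ`, the two spellings of the twisted point, the three fibre identifications
  set g : (specOver ℚ ℂ).left ⟶ (specOver ℚ ℂ).left := (AlgPoints.specMap σ).left with hg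
  have h1g : 𝟙 (Spec (CommRingCat.of ℂ)) ≫ g = AbelianSchemeOver.specTwist σ.toRingEquiv ≫ 𝟙 (Spec (CommRingCat.of ℂ)) :=
    id_comp_specMap_left_eq_specTwist_comp_id σ
  -- the three abelian varieties between `fibre(Pσ)_𝟙` and `fibre(P′)_𝟙`
  let A₁ := (P'.A.fibre (𝟙 (Spec (CommRingCat.of ℂ)))).toAbelianVariety
  let Ag := (P'.A.fibre (𝟙 (Spec (CommRingCat.of ℂ)) ≫ g)).toAbelianVariety
  let Aσ := (P'.A.fibre (AbelianSchemeOver.specTwist σ.toRingEquiv ≫ 𝟙 (Spec (CommRingCat.of ℂ)))).toAbelianVariety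
  let bc := P'.A.fibreBaseChangeIso g (𝟙 (Spec (CommRingCat.of ℂ)))
  let cg := P'.A.fibreCongrIso h1g
  let e := P'.A.conjFibreIso σ.toRingEquiv (𝟙 (Spec (CommRingCat.of ℂ)))
  -- `[M]` is dominant on every fibre involved
  haveI : IsDominant (AbelianVariety.Hom.toSchemeHom ((M : ℤ) • 𝟙 Ag)) :=
    AbelianVariety.isDominant_toSchemeHom_zsmul_of_ne_zero Ag hM
  haveI : IsDominant (AbelianVariety.Hom.toSchemeHom ((M : ℤ) • 𝟙 Aσ)) :=
    AbelianVariety.isDominant_toSchemeHom_zsmul_of_ne_zero Aσ hM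
  haveI : IsDominant (AbelianVariety.Hom.toSchemeHom ((M : ℤ) • 𝟙 (A₁.conjugate σ.toRingEquiv))) :=
    AbelianVariety.isDominant_toSchemeHom_zsmul_of_ne_zero _ hM
  haveI hbci : IsDominant (AbelianVariety.Hom.toSchemeHom bc.inv) :=
    AbelianVariety.isDominant_toSchemeHom_iso_hom bc.symm
  haveI hcgi : IsDominant (AbelianVariety.Hom.toSchemeHom cg.inv) :=
    AbelianVariety.isDominant_toSchemeHom_iso_hom cg.symm
  -- (a) `Θσ` descends to a witness of `λ̄_{P′}` at the point `𝟙 ≫ g` (★ §3a `IsLambdaOfAt.of_baseChange`)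
  have ha : P'.A.IsLambdaOfAt (𝟙 _ ≫ g) P'.D P'.pol.lam
      (Θσ.pullback (AbelianVariety.Hom.toSchemeHom bc.inv)) :=
    IsLambdaOfAt.of_baseChange P'.A g P'.D (𝟙 _) P'.pol.lam Θσ hlamσ
  -- (b) … hence at the point `specTwist σ ≫ 𝟙`
  have hb : P'.A.IsLambdaOfAt (AbelianSchemeOver.specTwist σ.toRingEquiv ≫ 𝟙 _) P'.D P'.pol.lam
      ((Θσ.pullback (AbelianVariety.Hom.toSchemeHom bc.inv)).pullback (AbelianVariety.Hom.toSchemeHom cg.inv)) :=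
    IsLambdaOfAt.of_point_eq P'.A P'.D P'.pol.lam h1g ha
  -- the corresponding torsion points of `A_{specTwist σ ≫ 𝟙}`
  let φ : ((P'.rebaseSpecMap σ).A.fibre (𝟙 (Spec (CommRingCat.of ℂ)))).toAbelianVariety ≅ Aσ := bc ≪≫ cg
  haveI hφi : IsDominant (AbelianVariety.Hom.toSchemeHom φ.inv) :=
    AbelianVariety.isDominant_toSchemeHom_iso_hom φ.symm
  let P'' : Aσ.torsionPoints ℂ M :=
    ⟨AlgPoints.map φ.hom.hom.hom.hom Pt.1, AbelianVariety.map_mem_torsionPoints φ.hom Pt.2⟩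
  let Q'' : Aσ.torsionPoints ℂ M :=
    ⟨AlgPoints.map φ.hom.hom.hom.hom Qt.1, AbelianVariety.map_mem_torsionPoints φ.hom Qt.2⟩
  -- `jσ = φ ≪≫ e.symm`, so `e(P^σ) = φ(Pt)`
  have hjσ : (P'.rebaseSpecMapConjIso σ).hom.hom.hom.hom = φ.hom.hom.hom.hom ≫ e.inv.hom.hom.hom := rfl
  have hP'' : AlgPoints.map e.hom.hom.hom.hom (A₁.conjPoints σ.toRingEquiv P.1) = P''.1 := by
    change _ = AlgPoints.map φ.hom.hom.hom.hom Pt.1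
    rw [← hP, hjσ, AlgPoints.map_comp_apply, AbelianVariety.map_hom_map_inv_of_iso]
  have hQ'' : AlgPoints.map e.hom.hom.hom.hom (A₁.conjPoints σ.toRingEquiv Q.1) = Q''.1 := by
    change _ = AlgPoints.map φ.hom.hom.hom.hom Qt.1
    rw [← hQ, hjσ, AlgPoints.map_comp_apply, AbelianVariety.map_hom_map_inv_of_iso]
  -- (c) the σ-reading on `P′.A` between the points `𝟙` and `specTwist σ ≫ 𝟙`
  haveI := P'.A.isDominant_toSchemeHom_conjFibreIso_inv_comp_baseChangeHomFst σ.toRingEquiv (𝟙 (Spec (CommRingCat.of ℂ)))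
  have hc := IsLambdaOfAt.weilPairingLevel_specTwist_eq_conjugate P'.A P'.D P'.pol.lam σ.toRingEquiv (𝟙 _)
    _ rfl hlam₁ hb P Q P'' Q'' hP'' hQ''
  -- (d) back to `(Θσ, Pt, Qt)` along `φ`
  have hsame : ((Θσ.pullback (AbelianVariety.Hom.toSchemeHom bc.inv)).pullback
      (AbelianVariety.Hom.toSchemeHom cg.inv)).SameDivisor (Θσ.pullback (AbelianVariety.Hom.toSchemeHom φ.inv)) := by
    haveI : IsDominant (AbelianVariety.Hom.toSchemeHom cg.inv ≫ AbelianVariety.Hom.toSchemeHom bc.inv) := hφi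
    exact Θσ.pullback_pullback_sameDivisor _ _
  have hd : Aσ.weilPairingLevel (Θσ.pullback (AbelianVariety.Hom.toSchemeHom φ.inv)) P'' Q'' =
      (((P'.rebaseSpecMap σ).A.fibre (𝟙 (Spec (CommRingCat.of ℂ)))).toAbelianVariety).weilPairingLevel Θσ Pt Qt :=
    AbelianVariety.weilPairingLevel_pullback_eq φ.inv Θσ P'' Q'' Pt Qt
      (AbelianVariety.map_inv_map_hom_of_iso φ Pt.1).symm (AbelianVariety.map_inv_map_hom_of_iso φ Qt.1).symm
  rw [← hd, ← AbelianVariety.weilPairingLevel_congr_sameDivisor hsame, hc]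
  rfl

end PolarizedAbelianSchemeWithLevel

end Literature.AlgebraicGeometry.AbelianSchemes

end
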